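import Summits.ResolutionOfSingularities.ResolutionOfSingularities.Theorems.JetCutBroadKernels2
import Summits.ResolutionOfSingularities.ResolutionOfSingularities.Theorems.JetCutVastKernels
import HarnessLib

/-!
# JetCutVastKernels2 — decomp-res node «JetCut» (lens-2 g15 rev 5), file 2/2 of `JetCutVastKernels`

Content VERBATIM from the decomp-res lens-2 file `HOME/decomp-res-lens-2/g15/JetCut.lean` rev 5 (pin 9f53e5ca =
`parts/JetCut-rev5-9f53e5ca.lean`, 7 495 l;
HOME = run/shared/lean/pub/decomp-res; CRITIC-LEDGER rows 109 / 115 / 120 / 121 / 122 / 127 / 133 CLEARED; landing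
order INBOX :231; the critic's
HYGIENE-landing.md h1–h11 applied — DOCSTRING-ONLY).  The lens's blocks RESTATED VERBATIM from lens-2 g12 / g13 /
g14 (§R / §R13 / §R14) are DELETED:
they are the tree's `RelativeDeltaCut*` / `CurveLeafExit*` / `PinchCut*` modules (namespaces `RelativeDeltaCut`,
`CurveLeafExit`, `PinchCut`, opened;
the lens's `CurveLeafExitRestated.x` / `PinchCutRestated.x` are cited as `CurveLeafExit.x` / `PinchCut.x`, the three
pointwise engine edges of g12 as
`RelativeDeltaCut.x`).  Namespace `…Theorems.JetCut` (the lens's `Theses.JetCut` is gate-reserved), sub-namespaces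
`Tame` / `Wide` / `Broad` / `Vast`
as in the lens; file split only (tree files ≤ 400 lines): sections, variables and every declaration exactly as in
the lens, the long rev-0/1 prose
lives in HOME/decomp-res-lens-2/g15/NODE-g15.md §ARCHIVE-A (not in the tree).  Node files, in import order:
`JetCutJetKernels`, `JetCutPoint`, `JetCutClasses`, `JetCutKernels`, `JetCutTame`, `JetCutTameClasses`,
`JetCutTameKernels`, `JetCutLadder`, `JetCutWideClasses`, `JetCutWideKernels`, `JetCutMixed`, `JetCutBroadClasses`,
`JetCutBroadKernels`, `JetCutDegenerate`, `JetCutVastClasses`, `JetCutVastKernels`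
(each possibly continued `…2`, `…3`), then the wiring `MaxContactCutJetCut*` (in the Theses cone).  All `--supports
stmt-ResolutionOfSingularities-29273`
(`MaxContactCut.RungOne`); nothing closes 29273 — decided cells carry their engines as hypotheses, and exactly ONE
located-residual aside is booked on
the route for this column (`Vast.VastSpecialRung`, home `JetCutVastClasses`).

§NK (namespace `Vast`) + the route-free refinement edges vast → broad → wide → tame → jet: pure-logic KERNELS of the
VAST cut (mechanical copy of §K; EXACT `Vast.seqDimFour_one_iff`, `Vast.vGenRungAt_of_engines`,
`Vast.vastGenericRung_of_engines`, the iff chain `Vast.*SpecialRung_iff_vastSpecialRung`) — VERBATIM, 0 sorry;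
`Vast.rungOne_iff` / `Vast.closes*` / edges naming route items are in `MaxContactCutJetCut*`.  [Writer: the lens's
two mechanical re-proofs `Vast.isCurveExitPt_of_isVastCurvePt` / `Vast.not_isVastSpecialPt_of_isVastCurvePt` — the
SAME statements as the §N2 originals in the enclosing namespace — are not repeated (the gate's dedup.landed lint
forbids restating a landed declaration); every use resolves to the original by namespace resolution, proofs unchanged.]

Part 2/2 carries: `vastSpecialRung_of_wideSpecialRung`, `vastSpecialRung_of_tameSpecialRung`,
`vastSpecialRung_of_jetSpecialRung`, `broadGenericRung_of_vastGenericRung`, `wideGenericRung_of_vastGenericRung`,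
`tameGenericRung_of_vastGenericRung`.

(Sources: HunekeSwanson2006 Cor. 5.5.5; CossartJannsenSaito2020 Ch. 2, Thm. 3.6/3.7, Ch. 8; CossartPiltant2008 Prop.
4.2; CossartPiltant2019 Rem. 3.2; Hironaka1964 Ch. III; Hironaka1967; Hironaka1977; Moh1987; Giraud1975.)
-/

open CategoryTheory AlgebraicGeometry TopologicalSpace IsLocalRing
open Literature.AlgebraicGeometry.Resolution
open Summit.ResolutionOfSingularities.ResolutionOfSingularities.Theorems
open Summit.ResolutionOfSingularities.ResolutionOfSingularities.Theorems.WeakOrderReduction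
open Summit.ResolutionOfSingularities.ResolutionOfSingularities.Theorems.DeltaFaceCutClasses
open Summit.ResolutionOfSingularities.ResolutionOfSingularities.Theorems.RelativeDeltaCut
open Summit.ResolutionOfSingularities.ResolutionOfSingularities.Theorems.CurveLeafExit
open Summit.ResolutionOfSingularities.ResolutionOfSingularities.Theorems.PinchCut

namespace Summit.ResolutionOfSingularities.ResolutionOfSingularities.Theorems.JetCut

namespace Vast

/-- rev 3's residual implies the vast residual. [folklore] -/
theorem vastSpecialRung_of_wideSpecialRung (h : Wide.WideSpecialRung) : VastSpecialRung :=
  vastSpecialRung_of_broadSpecialRung (Broad.broadSpecialRung_of_wideSpecialRung h)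

/-- rev 2's residual implies the vast residual. [folklore] -/
theorem vastSpecialRung_of_tameSpecialRung (h : Tame.TameSpecialRung) : VastSpecialRung :=
  vastSpecialRung_of_broadSpecialRung (Broad.broadSpecialRung_of_tameSpecialRung h)

/-- rev 0's residual implies the vast residual. [folklore] -/
theorem vastSpecialRung_of_jetSpecialRung (h : JetSpecialRung) : VastSpecialRung :=
  vastSpecialRung_of_broadSpecialRung (Broad.broadSpecialRung_of_jetSpecialRung h)

/-- The vast decided half implies the broad decided half. [folklore] -/
theorem broadGenericRung_of_vastGenericRung (h : VastGenericRung) : Broad.BroadGenericRung := by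
  intro hE2 n hn p hp k _ _ Y g h1 h2 h3 hY h4 I hord hcls
  refine h hE2 n hn p hp k Y g h1 h2 h3 hY h4 I hord ?_
  intro y hy
  rcases hcls y hy with h' | h' | h' | h' | h' | h' | h' | h' | h'
  · exact Or.inl h'
  · exact Or.inr (Or.inl h')
  · exact Or.inr (Or.inr (Or.inl h'))
  · exact Or.inr (Or.inr (Or.inr (Or.inl h')))
  · exact Or.inr (Or.inr (Or.inr (Or.inr (Or.inl h'))))
  · exact Or.inr (Or.inr (Or.inr (Or.inr (Or.inr (Or.inl h')))))
  · exact Or.inr (Or.inr (Or.inr (Or.inr (Or.inr (Or.inr (Or.inl h'))))))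
  · exact Or.inr (Or.inr (Or.inr (Or.inr (Or.inr (Or.inr (Or.inr (Or.inl h')))))))
  · exact Or.inr (Or.inr (Or.inr (Or.inr (Or.inr (Or.inr (Or.inr (Or.inr (isVastCurvePt_of_isBroadCurvePt h'))))))))

/-- The vast decided half implies the wide decided half. [folklore] -/
theorem wideGenericRung_of_vastGenericRung (h : VastGenericRung) : Wide.WideGenericRung :=
  Broad.wideGenericRung_of_broadGenericRung (broadGenericRung_of_vastGenericRung h)

/-- The vast decided half implies the tame decided half. [folklore] -/
theorem tameGenericRung_of_vastGenericRung (h : VastGenericRung) : Tame.TameGenericRung :=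
  Broad.tameGenericRung_of_broadGenericRung (broadGenericRung_of_vastGenericRung h)

end Vast

end Summit.ResolutionOfSingularities.ResolutionOfSingularities.Theorems.JetCut
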